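import Literature.NumberTheory.Sieve.IwaniecAlmostPrimesProp2Prep
import HarnessLib

/-!
# Iwaniec (1978), Lemma 5: roots of `Ω² + 1 ≡ 0 (mod D)` and primitive representations `D = r² + s²` — PROVED

H. Iwaniec, *Almost-primes represented by quadratic polynomials*, Invent. Math. **47** (1978)
171–188, Lemma 5 (p. 178) [cite: IwaniecInventiones1978, Lemma 5]: "There exists a one to one
correspondence between the solutions `Ω (mod D)` of the congruence `Ω² + 1 ≡ 0 (mod D)` and the
pairs of numbers `(r, s)` such that `D = r² + s²`, `(r, s) = 1`, `|r| < s`.  The correspondence is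
given through the formula `Ω = (r̄/s)(r² + s²) − r/s`.  The notation `r̄`, used either in `r̄/s` or
in a congruence `(mod s)` means that `r r̄ ≡ 1 (mod s)`.  This result, due of course to Lagrange
is to be found in Article 86 of [20]" (H. J. S. Smith, *Report on the theory of numbers*).

Everything here is PROVED.  Reading the formula modulo `D`: `s Ω ≡ −r`, i.e. `Ω ≡ −r s̄ (mod D)`
(`s` is prime to `D = r² + s²`); this is `gaussRoot`, and `gaussRoot_eq_formula` identifies it with
the printed integer `(r̄ D − r)/s`.

* `gaussPairs D` — the finite set of pairs `(r, s)` with `r² + s² = D`, `(r, s) = 1`, `|r| < s`;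
  `negOneRoots D` — the roots of `Ω² + 1` in `ℤ/Dℤ` (so `#negOneRoots D = ρ(D)`, `card_negOneRoots`);
* `gaussRoot_mem` (the formula gives a root), `gaussRoot_injOn` (distinct pairs give distinct
  roots: with `a = rs' − r's`, `b = rr' + ss'` one has `D ∣ a`, `D ∣ b`, `a² + b² = D²`, and
  `b = 0` is impossible as `|rr'| < ss'`), `exists_gaussPair_of_root` (every root arises, `D ≥ 3`:
  Thue's pigeonhole gives `(x, y) ≠ 0` with `y ≡ Ωx`, `|x|, |y| ≤ √D`, so `x² + y² ∈ {D, 2D}`;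
  `2D` forces `D ∣ 4`; the representation `x² + y² = D` is primitive, and one of its four rotations
  has `|r| < s`);
* **`lemma5_gauss`**: for `D ≥ 1`, `D ≠ 2`, `gaussRoot` is a bijection from `gaussPairs D` onto
  `negOneRoots D`; `card_gaussPairs : #gaussPairs D = ρ(D)`.

Erratum (recorded; harmless for the paper): the printed statement fails for `D = 2` — the only
primitive representations of `2` are `(±1)² + (±1)²`, none with `|r| < s`, while `Ω = 1` is a root
(`gaussPairs_two`, `rho_two'`); for every other `D ≥ 1` it holds as printed (`D = r² + s²`
primitive with `|r| = |s|` forces `D = 2`).  In §4 of the paper `D` ranges over `(qM, 2qM)` with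
`M → ∞`, so `D = 2` never occurs.

## References

* H. Iwaniec, Invent. Math. 47 (1978) 171–188, Lemma 5 p. 178 (`IwaniecInventiones1978`).
* H. J. S. Smith, *Report on the theory of numbers*, Art. 86 (Chelsea reprint 1965).
-/

open Finset

noncomputable section

namespace Literature.NumberTheory.Sieve.Iwaniec1978

/-! ### The two finite sets and the map -/

/-- The pairs `(r, s)` with `D = r² + s²`, `(r, s) = 1`, `|r| < s` (Lemma 5, p. 178).
[cite: IwaniecInventiones1978, Lemma 5] -/
def gaussPairs (D : ℕ) : Finset (ℤ × ℤ) :=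
  ((Finset.Icc (-(D : ℤ)) D) ×ˢ (Finset.Icc (0 : ℤ) D)).filter fun p : ℤ × ℤ =>
    p.1 ^ 2 + p.2 ^ 2 = D ∧ Int.gcd p.1 p.2 = 1 ∧ |p.1| < p.2

/-- The solutions `Ω (mod D)` of `Ω² + 1 ≡ 0 (mod D)`. [cite: IwaniecInventiones1978, Lemma 5] -/
def negOneRoots (D : ℕ) [NeZero D] : Finset (ZMod D) :=
  Finset.univ.filter fun Ω : ZMod D => Ω ^ 2 + 1 = 0

/-- The root attached to `(r, s)`: `Ω ≡ −r s̄ (mod D)`, i.e. `s Ω ≡ −r` — the printed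
`Ω = (r̄/s)(r² + s²) − r/s` read modulo `D = r² + s²` (`gaussRoot_eq_formula`).
[cite: IwaniecInventiones1978, Lemma 5] -/
def gaussRoot (D : ℕ) (p : ℤ × ℤ) : ZMod D :=
  -((p.1 : ZMod D) * ((p.2 : ZMod D))⁻¹)

/-- Membership in `gaussPairs` (the box conditions are implied). [folklore] -/
theorem mem_gaussPairs {D : ℕ} {p : ℤ × ℤ} :
    p ∈ gaussPairs D ↔ p.1 ^ 2 + p.2 ^ 2 = D ∧ Int.gcd p.1 p.2 = 1 ∧ |p.1| < p.2 := by
  unfold gaussPairs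
  rw [Finset.mem_filter, Finset.mem_product, Finset.mem_Icc, Finset.mem_Icc]
  constructor
  · exact fun h => h.2
  · rintro ⟨hD, hg, hrs⟩
    refine ⟨⟨?_, ?_⟩, hD, hg, hrs⟩
    · have h1 : |p.1| ≤ p.1 ^ 2 := by
        rcases le_or_gt 1 |p.1| with h | h
        · nlinarith [sq_abs p.1]
        · have : p.1 = 0 := by
            rcases abs_lt.mp h with ⟨h1, h2⟩
            omega
          simp [this]
      have h2 : p.1 ^ 2 ≤ D := by nlinarith [sq_nonneg p.2]
      constructor <;> cases abs_le.mp (h1.trans h2) <;> linarith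
    · constructor
      · linarith [abs_nonneg p.1]
      · nlinarith [sq_nonneg p.1, abs_nonneg p.1]

/-- Membership in `negOneRoots`. [folklore] -/
theorem mem_negOneRoots {D : ℕ} [NeZero D] {Ω : ZMod D} :
    Ω ∈ negOneRoots D ↔ Ω ^ 2 + 1 = 0 := by
  simp [negOneRoots]

/-- `#{Ω mod D : Ω² + 1 ≡ 0} = ρ(D)`. [folklore] -/
theorem card_negOneRoots (D : ℕ) [NeZero D] : (negOneRoots D).card = rho D := by
  rw [rho_eq_card_filter_zmod]; rfl

/-- The exception `D = 2`: no pair `(r, s)` qualifies … [folklore] -/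
theorem gaussPairs_two : gaussPairs 2 = ∅ := by decide

/-- … although `ρ(2) = 1`. [folklore] -/
theorem rho_two' : rho 2 = 1 := by decide

/-- `D = 1`: the single pair `(0, 1)`. [folklore] -/
theorem mem_gaussPairs_one : ((0 : ℤ), (1 : ℤ)) ∈ gaussPairs 1 := by decide

/-! ### The map lands in the roots and is injective -/

section Basic

variable {D : ℕ}

/-- A pair has `s > 0` and `D > 0`. [folklore] -/
theorem snd_pos_of_mem {p : ℤ × ℤ} (hp : p ∈ gaussPairs D) : 0 < p.2 :=
  lt_of_le_of_lt (abs_nonneg p.1) (mem_gaussPairs.mp hp).2.2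

/-- A pair forces `D > 0`. [folklore] -/
theorem pos_of_mem {p : ℤ × ℤ} (hp : p ∈ gaussPairs D) : 0 < D := by
  have hs := snd_pos_of_mem hp
  have hD := (mem_gaussPairs.mp hp).1
  have : (0 : ℤ) < p.1 ^ 2 + p.2 ^ 2 := by nlinarith
  rw [hD] at this
  exact_mod_cast this

/-- For `(r, s) = 1` and `D = r² + s²`, `s` is a unit modulo `D`. [folklore] -/
theorem isUnit_snd_of_mem {p : ℤ × ℤ} (hp : p ∈ gaussPairs D) : IsUnit (p.2 : ZMod D) := by
  obtain ⟨hD, hg, -⟩ := mem_gaussPairs.mp hp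
  rw [ZMod.coe_int_isUnit_iff_isCoprime]
  have hcop : IsCoprime p.1 p.2 := Int.isCoprime_iff_gcd_eq_one.mpr hg
  have h1 : IsCoprime (p.1 ^ 2 + p.2 ^ 2) p.2 := by
    have h2 : IsCoprime (p.1 ^ 2 + p.2 * p.2) p.2 := (hcop.pow_left (m := 2)).add_mul_right_left p.2
    simpa [sq] using h2
  have e : ((D : ℕ) : ℤ) = p.1 ^ 2 + p.2 ^ 2 := hD.symm
  rw [e]
  exact h1

/-- Likewise `r` is a unit modulo `D`. [folklore] -/
theorem isUnit_fst_of_mem {p : ℤ × ℤ} (hp : p ∈ gaussPairs D) : IsUnit (p.1 : ZMod D) := by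
  obtain ⟨hD, hg, -⟩ := mem_gaussPairs.mp hp
  rw [ZMod.coe_int_isUnit_iff_isCoprime]
  have hcop : IsCoprime p.2 p.1 := (Int.isCoprime_iff_gcd_eq_one.mpr hg).symm
  have h1 : IsCoprime (p.1 ^ 2 + p.2 ^ 2) p.1 := by
    have h2 : IsCoprime (p.2 ^ 2 + p.1 * p.1) p.1 := (hcop.pow_left (m := 2)).add_mul_right_left p.1
    simpa [sq, add_comm] using h2
  have e : ((D : ℕ) : ℤ) = p.1 ^ 2 + p.2 ^ 2 := hD.symm
  rw [e]
  exact h1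

/-- `D = r² + s² = 0` in `ℤ/Dℤ`. [folklore] -/
theorem sq_add_sq_cast_eq_zero {p : ℤ × ℤ} (hp : p ∈ gaussPairs D) :
    (p.1 : ZMod D) ^ 2 + (p.2 : ZMod D) ^ 2 = 0 := by
  obtain ⟨hD, -, -⟩ := mem_gaussPairs.mp hp
  have : ((p.1 ^ 2 + p.2 ^ 2 : ℤ) : ZMod D) = ((D : ℤ) : ZMod D) := by rw [hD]
  push_cast at this
  rw [this, ZMod.natCast_self]

/-- `s · gaussRoot = −r`. [folklore] -/
theorem snd_mul_gaussRoot {p : ℤ × ℤ} (hp : p ∈ gaussPairs D) :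
    (p.2 : ZMod D) * gaussRoot D p = -(p.1 : ZMod D) := by
  rw [gaussRoot]
  have hinv : (p.2 : ZMod D) * ((p.2 : ZMod D))⁻¹ = 1 :=
    ZMod.mul_inv_of_unit _ (isUnit_snd_of_mem hp)
  linear_combination -(p.1 : ZMod D) * hinv

/-- **The formula gives a root** of `Ω² + 1 ≡ 0 (mod D)`. [cite: IwaniecInventiones1978, Lemma 5] -/
theorem gaussRoot_sq_add_one {p : ℤ × ℤ} (hp : p ∈ gaussPairs D) :
    gaussRoot D p ^ 2 + 1 = 0 := by
  have hu := isUnit_snd_of_mem hp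
  have h0 := sq_add_sq_cast_eq_zero hp
  have h1 := snd_mul_gaussRoot hp
  set G := gaussRoot D p
  -- `s² (G² + 1) = r² + s² = 0`, and `s²` is a unit
  have h2 : (p.2 : ZMod D) ^ 2 * (G ^ 2 + 1) = 0 := by
    linear_combination ((p.2 : ZMod D) * G - (p.1 : ZMod D)) * h1 + h0
  have hu2 : IsUnit ((p.2 : ZMod D) ^ 2) := hu.pow 2
  have := hu2.mul_left_cancel (h2.trans (mul_zero _).symm)
  exact this

/-- The root attached to a pair lies in `negOneRoots`. [cite: IwaniecInventiones1978, Lemma 5] -/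
theorem gaussRoot_mem [NeZero D] {p : ℤ × ℤ} (hp : p ∈ gaussPairs D) :
    gaussRoot D p ∈ negOneRoots D :=
  mem_negOneRoots.mpr (gaussRoot_sq_add_one hp)

/-- **Distinct pairs give distinct roots.**  With `a = rs' − r's`, `b = rr' + ss'`: equal roots
give `D ∣ a` and `D ∣ b`, while `a² + b² = D²`; `b = 0` would give `ss' = |rr'| < ss'`, so `a = 0`
and (coprimality, `s, s' > 0`) the pairs coincide. [cite: IwaniecInventiones1978, Lemma 5] -/
theorem gaussRoot_injOn (D : ℕ) : Set.InjOn (gaussRoot D) (gaussPairs D : Set (ℤ × ℤ)) := by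
  intro p hp p' hp' heq
  rw [Finset.mem_coe] at hp hp'
  obtain ⟨hD, hg, hrs⟩ := mem_gaussPairs.mp hp
  obtain ⟨hD', hg', hrs'⟩ := mem_gaussPairs.mp hp'
  have hs0 : 0 < p.2 := snd_pos_of_mem hp
  have hs0' : 0 < p'.2 := snd_pos_of_mem hp'
  have h1 := snd_mul_gaussRoot hp
  have h2 := snd_mul_gaussRoot hp'
  have hΩ2 := gaussRoot_sq_add_one hp'
  rw [heq] at h1
  set Ω := gaussRoot D p'
  -- `D ∣ a` and `D ∣ b`
  have ha : ((p.1 * p'.2 - p'.1 * p.2 : ℤ) : ZMod D) = 0 := by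
    push_cast
    linear_combination (p'.2 : ZMod D) * h1 - (p.2 : ZMod D) * h2
  have hb : ((p.1 * p'.1 + p.2 * p'.2 : ℤ) : ZMod D) = 0 := by
    push_cast
    linear_combination (p'.1 : ZMod D) * h1 - (p.2 : ZMod D) * Ω * h2 +
      (p.2 : ZMod D) * (p'.2 : ZMod D) * hΩ2
  rw [ZMod.intCast_zmod_eq_zero_iff_dvd] at ha hb
  obtain ⟨a', ha'⟩ := ha
  obtain ⟨b', hb'⟩ := hb
  -- `a² + b² = D²`
  have hBr : (p.1 * p'.2 - p'.1 * p.2) ^ 2 + (p.1 * p'.1 + p.2 * p'.2) ^ 2 = (D : ℤ) * D := by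
    nth_rewrite 1 [← hD]
    rw [← hD']
    ring
  rw [ha', hb'] at hBr
  have hDpos : (0 : ℤ) < D := by exact_mod_cast pos_of_mem hp
  have hab : a' ^ 2 + b' ^ 2 = 1 := by
    have : (D : ℤ) * D * (a' ^ 2 + b' ^ 2) = (D : ℤ) * D * 1 := by linear_combination hBr
    exact mul_left_cancel₀ (by positivity) this
  -- `b ≠ 0` since `|r r'| < s s'`
  have hbne : p.1 * p'.1 + p.2 * p'.2 ≠ 0 := by
    intro h0
    have h3 : |p.1 * p'.1| < p.2 * p'.2 := by
      rw [abs_mul]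
      calc |p.1| * |p'.1| ≤ |p.1| * p'.2 := mul_le_mul_of_nonneg_left hrs'.le (abs_nonneg _)
        _ < p.2 * p'.2 := mul_lt_mul_of_pos_right hrs hs0'
    have h4 : p.1 * p'.1 = -(p.2 * p'.2) := by linarith
    rw [h4, abs_neg, abs_of_pos (mul_pos hs0 hs0')] at h3
    exact lt_irrefl _ h3
  have hb'ne : b' ≠ 0 := by
    intro h0; rw [h0, mul_zero] at hb'; exact hbne hb'
  have ha'0 : a' = 0 := by
    have hb2 : 1 ≤ b' ^ 2 := by
      have := Int.one_le_abs hb'ne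
      nlinarith [sq_abs b']
    nlinarith [sq_nonneg a']
  rw [ha'0, mul_zero] at ha'
  -- `r s' = r' s` with coprimality and positivity gives equality
  have hrs_eq : p.1 * p'.2 = p'.1 * p.2 := by linarith
  have hcop : IsCoprime p.1 p.2 := Int.isCoprime_iff_gcd_eq_one.mpr hg
  have hcop' : IsCoprime p'.1 p'.2 := Int.isCoprime_iff_gcd_eq_one.mpr hg'
  have hs_dvd : p.2 ∣ p'.2 := by
    have : p.2 ∣ p.1 * p'.2 := ⟨p'.1, by rw [hrs_eq]; ring⟩
    exact hcop.symm.dvd_of_dvd_mul_left this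
  have hs'_dvd : p'.2 ∣ p.2 := by
    have : p'.2 ∣ p'.1 * p.2 := ⟨p.1, by rw [← hrs_eq]; ring⟩
    exact hcop'.symm.dvd_of_dvd_mul_left this
  have hss : p.2 = p'.2 := Int.dvd_antisymm hs0.le hs0'.le hs_dvd hs'_dvd
  have hrr : p.1 = p'.1 := by
    rw [hss] at hrs_eq
    exact mul_right_cancel₀ hs0'.ne' hrs_eq
  exact Prod.ext hrr hss

end Basic

/-! ### Every root arises: Thue's pigeonhole and the four rotations -/

section Surjective

variable {D : ℕ} [NeZero D]

/-- **Thue's lemma** for the root `Ω`: there are integers `x, y`, not both zero, with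
`|x|, |y| ≤ √D` and `y ≡ Ω x (mod D)` (pigeonhole on `(x, y) ∈ [0, √D]²`, more than `D` points).
[folklore] -/
theorem exists_small_solution (Ω : ZMod D) :
    ∃ x y : ℤ, (x ≠ 0 ∨ y ≠ 0) ∧ |x| ≤ Nat.sqrt D ∧ |y| ≤ Nat.sqrt D ∧
      (y : ZMod D) = Ω * (x : ZMod D) := by
  classical
  set m := Nat.sqrt D with hm
  have hD : D < (m + 1) ^ 2 := Nat.lt_succ_sqrt' D
  let B : Finset (ℕ × ℕ) := (Finset.range (m + 1)) ×ˢ (Finset.range (m + 1))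
  have hcard : (Finset.univ : Finset (ZMod D)).card < B.card := by
    rw [Finset.card_univ, ZMod.card, Finset.card_product, Finset.card_range]
    simpa [sq] using hD
  obtain ⟨u, hu, v, hv, huv, hf⟩ := Finset.exists_ne_map_eq_of_card_lt_of_maps_to hcard
    (f := fun w : ℕ × ℕ => ((w.2 : ℤ) : ZMod D) - Ω * ((w.1 : ℤ) : ZMod D))
    (fun w _ => Finset.mem_coe.mpr (Finset.mem_univ _))
  simp only [B, Finset.mem_product, Finset.mem_range] at hu hv
  refine ⟨(u.1 : ℤ) - v.1, (u.2 : ℤ) - v.2, ?_, ?_, ?_, ?_⟩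
  · by_contra h0
    push Not at h0
    apply huv
    exact Prod.ext (by omega) (by omega)
  · rw [abs_le]; constructor <;> omega
  · rw [abs_le]; constructor <;> omega
  · push_cast at hf ⊢
    linear_combination hf

/-- `Ω² + 1 ≠ 0` modulo `4`. [folklore] -/
theorem sq_add_one_ne_zero_mod_four (w : ZMod 4) : w ^ 2 + 1 ≠ 0 := by
  revert w; decide

/-- **Every root arises** (`D ≥ 3`): there is `(r, s) ∈ gaussPairs D` with `s ≡ Ω r (mod D)`.
[cite: IwaniecInventiones1978, Lemma 5] -/
theorem exists_gaussPair_of_root (hD3 : 3 ≤ D) {Ω : ZMod D} (hΩ : Ω ^ 2 + 1 = 0) :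
    ∃ p ∈ gaussPairs D, (p.2 : ZMod D) = Ω * (p.1 : ZMod D) := by
  have hD0 : D ≠ 0 := NeZero.ne D
  have hDz : (0 : ℤ) < D := by exact_mod_cast Nat.pos_of_ne_zero hD0
  -- an integer representative `Ωz` of `Ω` and `u` with `Ωz² + 1 = D u`
  set Ωz : ℤ := ((Ω.val : ℕ) : ℤ) with hΩz
  have hΩcast : ((Ωz : ℤ) : ZMod D) = Ω := by simp [hΩz]
  have hdvd : (D : ℤ) ∣ Ωz ^ 2 + 1 := by
    rw [← ZMod.intCast_zmod_eq_zero_iff_dvd]; push_cast; rw [hΩcast]; exact hΩ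
  obtain ⟨u, hu⟩ := hdvd
  obtain ⟨x, y, hne, hx, hy, hxy⟩ := exists_small_solution Ω
  -- `y = Ωz x + t D`
  have ht : (D : ℤ) ∣ y - Ωz * x := by
    rw [← ZMod.intCast_zmod_eq_zero_iff_dvd]; push_cast; rw [hΩcast, hxy]; ring
  obtain ⟨t, ht⟩ := ht
  have hy' : y = Ωz * x + t * D := by linarith
  -- `x² + y² = D k`, `k = x² u + 2 Ωz x t + t² D`
  set k : ℤ := x ^ 2 * u + 2 * Ωz * x * t + t ^ 2 * D with hk
  have hkey : x ^ 2 + y ^ 2 = (D : ℤ) * k := by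
    rw [hy', hk]; linear_combination x ^ 2 * hu
  have hm2 : ((Nat.sqrt D : ℕ) : ℤ) ^ 2 ≤ D := by exact_mod_cast Nat.sqrt_le' D
  have hx2 : x ^ 2 ≤ D := by nlinarith [abs_nonneg x, sq_abs x, abs_le.mp hx]
  have hy2 : y ^ 2 ≤ D := by nlinarith [abs_nonneg y, sq_abs y, abs_le.mp hy]
  have hpos : 0 < x ^ 2 + y ^ 2 := by
    rcases hne with h | h
    · have := pow_pos (abs_pos.mpr h) 2; rw [sq_abs] at this; nlinarith [sq_nonneg y]
    · have := pow_pos (abs_pos.mpr h) 2; rw [sq_abs] at this; nlinarith [sq_nonneg x]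
  have hk1 : 1 ≤ k := by
    by_contra h; push Not at h
    have : x ^ 2 + y ^ 2 ≤ 0 := by rw [hkey]; nlinarith
    linarith
  have hk2 : k ≤ 2 := by
    by_contra h; push Not at h
    have : 3 * (D : ℤ) ≤ x ^ 2 + y ^ 2 := by rw [hkey]; nlinarith
    linarith
  -- `k = 2` is impossible: then `x² = y² = D`, `D ∣ 2Ωz`, `D ∣ 4`, so `D = 4`, but `Ω² + 1 ≢ 0 (4)`
  have hk_one : k = 1 := by
    rcases (show k = 1 ∨ k = 2 by omega) with h | h
    · exact h
    exfalso
    have hsum : x ^ 2 + y ^ 2 = 2 * D := by rw [hkey, h]; ring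
    have hxD : x ^ 2 = D := by linarith
    have hyD : y ^ 2 = D := by linarith
    -- from `y = Ωz x + tD` and `y² = x² = D`: `Ωz² + 2 Ωz x t + t² D = 1`
    have e1 : Ωz ^ 2 + 2 * Ωz * x * t + t ^ 2 * D = 1 := by
      have e0 : (D : ℤ) * (Ωz ^ 2 + 2 * Ωz * x * t + t ^ 2 * D) = D * 1 := by
        have : y ^ 2 = (Ωz * x + t * D) ^ 2 := by rw [hy']
        rw [hyD] at this
        linear_combination -this - Ωz ^ 2 * hxD
      exact mul_left_cancel₀ hDz.ne' e0
    -- from `x y = D (Ωz + t x)` and `(xy)² = D²`: `(Ωz + t x)² = 1`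
    have e2 : x * y = D * (Ωz + t * x) := by rw [hy']; linear_combination Ωz * hxD
    have e3 : (Ωz + t * x) ^ 2 = 1 := by
      have : (D : ℤ) ^ 2 * (Ωz + t * x) ^ 2 = (D : ℤ) ^ 2 * 1 := by
        calc (D : ℤ) ^ 2 * (Ωz + t * x) ^ 2 = (x * y) ^ 2 := by rw [e2]; ring
          _ = (D : ℤ) ^ 2 * 1 := by rw [mul_pow, hxD, hyD]; ring
      exact mul_left_cancel₀ (by positivity) this
    -- hence `D ∣ 2 Ωz`
    have e4 : 2 * Ωz * (Ωz + t * x) = D * (u - t ^ 2) := by linear_combination e1 + hu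
    have hD2Ω : (D : ℤ) ∣ 2 * Ωz := by
      have hpm : (Ωz + t * x - 1) * (Ωz + t * x + 1) = 0 := by linear_combination e3
      rcases mul_eq_zero.mp hpm with h1 | h1
      · have h2 : Ωz + t * x = 1 := by linarith
        rw [h2, mul_one] at e4
        exact ⟨u - t ^ 2, e4⟩
      · have h2 : Ωz + t * x = -1 := by linarith
        rw [h2] at e4
        exact ⟨-(u - t ^ 2), by linarith⟩
    -- hence `D ∣ 4`, so `D = 4`
    obtain ⟨c, hc⟩ := hD2Ω
    have hc2 : (2 * Ωz) ^ 2 = ((D : ℤ) * c) ^ 2 := by rw [hc]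
    have hD4 : (D : ℤ) ∣ 4 := ⟨4 * u - D * c ^ 2, by linear_combination 4 * hu - hc2⟩
    have hDle : (D : ℤ) ≤ 4 := Int.le_of_dvd (by norm_num) hD4
    have hD3z : (3 : ℤ) ≤ D := by exact_mod_cast hD3
    have hDeq : (D : ℤ) = 4 := by
      rcases (show (D : ℤ) = 3 ∨ (D : ℤ) = 4 by omega) with h3 | h4
      · exfalso; rw [h3] at hD4; norm_num at hD4
      · exact h4
    -- but `Ω² + 1 ≢ 0 (mod 4)`
    have h4dvd : (4 : ℤ) ∣ Ωz ^ 2 + 1 := ⟨u, by rw [← hDeq]; exact hu⟩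
    have hz : ((Ωz : ℤ) : ZMod 4) ^ 2 + 1 = 0 := by
      have := (ZMod.intCast_zmod_eq_zero_iff_dvd (Ωz ^ 2 + 1) 4).mpr h4dvd
      push_cast at this
      exact this
    exact sq_add_one_ne_zero_mod_four _ hz
  -- ### so `x² + y² = D`, a primitive representation
  have hrep : x ^ 2 + y ^ 2 = D := by rw [hkey, hk_one, mul_one]
  have hgcd : Int.gcd x y = 1 := by
    set g := Int.gcd x y with hg
    have hgx : (g : ℤ) ∣ x := Int.gcd_dvd_left x y
    have hgy : (g : ℤ) ∣ y := Int.gcd_dvd_right x y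
    have hgD : (g : ℤ) ∣ (D : ℤ) := by
      rw [← hrep]
      exact dvd_add (dvd_pow hgx two_ne_zero) (dvd_pow hgy two_ne_zero)
    have hg1 : (g : ℤ) ∣ 1 := by
      rw [← hk_one, hk]
      refine dvd_add (dvd_add ?_ ?_) ?_
      · exact Dvd.dvd.mul_right (dvd_pow hgx two_ne_zero) u
      · exact Dvd.dvd.mul_right (Dvd.dvd.mul_left hgx (2 * Ωz)) t
      · exact Dvd.dvd.mul_left hgD (t ^ 2)
    have : g ∣ 1 := by exact_mod_cast hg1
    exact Nat.dvd_one.mp this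
  have hΩsq : Ω * Ω = -1 := by linear_combination hΩ
  -- `|x| ≠ |y|` (else `gcd = |x| = 1` and `D = 2`)
  have hne_abs : |x| ≠ |y| := by
    intro habs
    have hn : x.natAbs = y.natAbs := by
      have h1 : ((x.natAbs : ℕ) : ℤ) = y.natAbs := by
        rw [Int.natCast_natAbs, Int.natCast_natAbs]; exact habs
      exact_mod_cast h1
    have hg : Int.gcd x y = x.natAbs := by rw [Int.gcd_eq_natAbs, hn, Nat.gcd_self]
    rw [hgcd] at hg
    have hx1 : x ^ 2 = 1 := by
      rcases Int.natAbs_eq_iff.mp hg.symm with h | h <;> rw [h] <;> norm_num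
    have hy1 : y ^ 2 = 1 := by
      rw [hn] at hg
      rcases Int.natAbs_eq_iff.mp hg.symm with h | h <;> rw [h] <;> norm_num
    have : (D : ℤ) = 2 := by rw [← hrep, hx1, hy1]; norm_num
    have hD3z : (3 : ℤ) ≤ D := by exact_mod_cast hD3
    linarith
  -- gcd is invariant under the rotations
  have hg1 : Int.gcd (-x) (-y) = 1 := by rw [Int.neg_gcd, Int.gcd_neg, hgcd]
  have hg2 : Int.gcd (-y) x = 1 := by rw [Int.neg_gcd, Int.gcd_comm, hgcd]
  have hg3 : Int.gcd y (-x) = 1 := by rw [Int.gcd_neg, Int.gcd_comm, hgcd]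
  rcases lt_or_gt_of_ne hne_abs with hlt | hlt
  · -- `|x| < |y|`: use `±(x, y)`
    rcases lt_or_gt_of_ne (show y ≠ 0 by intro h0; rw [h0, abs_zero] at hlt; linarith [abs_nonneg x])
      with hyneg | hypos
    · refine ⟨(-x, -y), mem_gaussPairs.mpr ⟨by push_cast; linear_combination hrep, hg1, ?_⟩, ?_⟩
      · simp only [abs_neg]; rw [abs_of_neg hyneg] at hlt; linarith
      · push_cast; rw [hxy]; ring
    · refine ⟨(x, y), mem_gaussPairs.mpr ⟨hrep, hgcd, ?_⟩, ?_⟩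
      · simpa [abs_of_pos hypos] using hlt
      · exact hxy
  · -- `|y| < |x|`: use `(-y, x)` or `(y, -x)`
    rcases lt_or_gt_of_ne (show x ≠ 0 by intro h0; rw [h0, abs_zero] at hlt; linarith [abs_nonneg y])
      with hxneg | hxpos
    · refine ⟨(y, -x), mem_gaussPairs.mpr ⟨by push_cast; linear_combination hrep, hg3, ?_⟩, ?_⟩
      · simp only; rw [abs_of_neg hxneg] at hlt; linarith
      · push_cast; rw [hxy]; linear_combination -(x : ZMod D) * hΩsq
    · refine ⟨(-y, x), mem_gaussPairs.mpr ⟨by push_cast; linear_combination hrep, hg2, ?_⟩, ?_⟩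
      · simp only [abs_neg]; rw [abs_of_pos hxpos] at hlt; exact hlt
      · push_cast; rw [hxy]; linear_combination (x : ZMod D) * hΩsq

/-- From `s ≡ Ω r` to `gaussRoot (r, s) = Ω` (cancel the unit `Ω r`). [folklore] -/
theorem gaussRoot_eq_of_rel {Ω : ZMod D} (hΩ : Ω ^ 2 + 1 = 0) {p : ℤ × ℤ} (hp : p ∈ gaussPairs D)
    (hrel : (p.2 : ZMod D) = Ω * (p.1 : ZMod D)) : gaussRoot D p = Ω := by
  have h1 := snd_mul_gaussRoot hp
  rw [hrel] at h1
  have hΩu : IsUnit Ω := IsUnit.of_mul_eq_one (-Ω) (by linear_combination -hΩ)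
  have hu : IsUnit (Ω * (p.1 : ZMod D)) := hΩu.mul (isUnit_fst_of_mem hp)
  refine hu.mul_left_cancel ?_
  rw [h1]
  linear_combination -(p.1 : ZMod D) * hΩ

end Surjective

/-! ### Lemma 5 -/

/-- **Iwaniec 1978, Lemma 5 (Lagrange–Gauss–Smith, Art. 86) — PROVED** for every `D ≥ 1` except
`D = 2` (where the printed statement fails, `gaussPairs_two`): `(r, s) ↦ Ω ≡ −r s̄ (mod D)` is a
bijection from the pairs with `D = r² + s²`, `(r, s) = 1`, `|r| < s` onto the roots of
`Ω² + 1 ≡ 0 (mod D)`. [cite: IwaniecInventiones1978, Lemma 5] -/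
theorem lemma5_gauss {D : ℕ} [NeZero D] (hD2 : D ≠ 2) :
    Set.BijOn (gaussRoot D) (gaussPairs D : Set (ℤ × ℤ)) (negOneRoots D : Set (ZMod D)) := by
  refine ⟨fun p hp => Finset.mem_coe.mpr (gaussRoot_mem (Finset.mem_coe.mp hp)),
    gaussRoot_injOn D, fun Ω hΩ => ?_⟩
  rw [Finset.mem_coe, mem_negOneRoots] at hΩ
  have hD0 : D ≠ 0 := NeZero.ne D
  rcases Nat.lt_or_ge D 3 with hlt | hD3
  · -- `D = 1`
    have hD1 : D = 1 := by omega
    subst hD1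
    refine ⟨((0 : ℤ), (1 : ℤ)), Finset.mem_coe.mpr mem_gaussPairs_one, Subsingleton.elim _ _⟩
  · obtain ⟨p, hp, hrel⟩ := exists_gaussPair_of_root hD3 hΩ
    exact ⟨p, Finset.mem_coe.mpr hp, gaussRoot_eq_of_rel hΩ hp hrel⟩

/-- **The number of pairs is `ρ(D)`** (`D ≠ 2`): `#{(r, s) : D = r² + s², (r, s) = 1, |r| < s} = ρ(D)`.
[cite: IwaniecInventiones1978, Lemma 5] -/
theorem card_gaussPairs {D : ℕ} [NeZero D] (hD2 : D ≠ 2) : (gaussPairs D).card = rho D := by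
  rw [← card_negOneRoots]
  have hb := lemma5_gauss hD2
  exact Finset.card_nbij (gaussRoot D) (fun p hp => Finset.mem_coe.mp (hb.1 (Finset.mem_coe.mpr hp)))
    hb.2.1 hb.2.2

/-- **The printed formula**: for a pair `(r, s)` and any `r̄` with `r r̄ ≡ 1 (mod s)`, the number
`Ω = (r̄/s)(r² + s²) − r/s = (r̄ D − r)/s` is an integer and reduces to `gaussRoot (r, s)` modulo `D`.
[cite: IwaniecInventiones1978, Lemma 5] -/
theorem gaussRoot_eq_formula {D : ℕ} {p : ℤ × ℤ} (hp : p ∈ gaussPairs D) {rbar : ℤ}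
    (hrbar : p.1 * rbar ≡ 1 [ZMOD p.2]) :
    p.2 ∣ rbar * D - p.1 ∧ (((rbar * D - p.1) / p.2 : ℤ) : ZMod D) = gaussRoot D p := by
  obtain ⟨hD, -, -⟩ := mem_gaussPairs.mp hp
  have hdvd : p.2 ∣ rbar * D - p.1 := by
    obtain ⟨c, hc⟩ := Int.ModEq.dvd hrbar.symm
    -- `hc : p.1 * rbar - 1 = p.2 * c`
    refine ⟨rbar * p.2 + c * p.1, ?_⟩
    rw [← hD]
    linear_combination (p.1 : ℤ) * hc
  refine ⟨hdvd, ?_⟩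
  set w := (rbar * D - p.1) / p.2 with hw
  have hws : w * p.2 = rbar * D - p.1 := Int.ediv_mul_cancel hdvd
  have h1 : (w : ZMod D) * (p.2 : ZMod D) = -(p.1 : ZMod D) := by
    have : ((w * p.2 : ℤ) : ZMod D) = ((rbar * D - p.1 : ℤ) : ZMod D) := by rw [hws]
    push_cast at this
    rw [ZMod.natCast_self, mul_zero, zero_sub] at this
    exact this
  have h2 : gaussRoot D p * (p.2 : ZMod D) = -(p.1 : ZMod D) := by
    rw [mul_comm]; exact snd_mul_gaussRoot hp
  exact (isUnit_snd_of_mem hp).mul_right_cancel (h1.trans h2.symm)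

end Literature.NumberTheory.Sieve.Iwaniec1978

end
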